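import Summits.Ventures.Crystal3D.Theorems.StickyWulffConstantGenericWallFloorCutNormals
import Summits.Ventures.Crystal3D.Theorems.StickyWulffConstantGenericWallFloorSiteLedger
import Summits.Ventures.Crystal3D.Theorems.StickyWulffConstantNoReconstructionGainCubicFrame
import HarnessLib

/-!
# Near-identity cap lemma for mixed kissing dozens, part 3a: the cubic frame as an orthonormal
# coordinate system and the twelve slots as lattice vectors (plumbing for the lattice form of M7/Σ1)

HONEST FRAMING. Part of the venture `Summits/Ventures/Crystal3D` (cell `crystal3d-full`), helper
`--supports` the crux `GenericWallFloor` (stmt-Ventures-19480, `route-Ventures-StickyWulffConstant`),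
REGISTERED line `WallLedgerG`, stub `stub_twoSlabAdhesion`, rigid-bicrystal rung, module M7 (coincidence
top sites), Σ1 part.  Rung credit only; pure plumbing between `…CutNormals` (matrix form on
`Fin 3 → ℝ`) and the lattice vocabulary (`EuclideanSpace ℝ (Fin 3)`, `fccSlots`, linear isometries):

* `cubicCoords` — orthonormal cubic coordinates `(A x, B x, C x)/√2` (functionals of
  `…NoReconstructionGainCubicFrame`); additive/homogeneous; `norm_sq_eq_cubicCoords`,
  **`inner_eq_cubicCoords`** (Parseval, by polarisation of `two_mul_norm_sq_eq_cubic`); injective;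
* `cubicFrame` — the three unit vectors with `cubicCoords (cubicFrame i) = eᵢ`; `inner_cubicFrame`;
  `cubicFrame_eq_slots` (each is `1/√2 ×` a sum/difference of two slots);
* the matrix `M i j = cubicCoords (L cⱼ) i` of a linear isometry `L`: `cubicCoords_map`
  (`cubicCoords (L w) = M · cubicCoords w`), `cubicMatrix_orthogonal`, `cubicMatrix_horth` (the
  hypothesis `horth` of `…NearIdentityCore` for `κ = M − 1`), `cubicMatrix_frob`
  (`‖M − 1‖_F² = Σⱼ ‖L cⱼ − cⱼ‖²`);
* `slotKIJ` / `slotSite` — the twelve slots as vectors of `Λ₀` in the order of `NearIdentity.slotInt`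
  (table check `slotKIJ_facts` by `decide`), `slotSite_mem`, `exists_slotSite_eq`, `slotSite_injective`,
  `fccSlots_eq_image`, **`cubicCoords_slotSite : cubicCoords (slotSite k) = slotVec k`**.
WHAT THIS IS NOT: any statement about packings; rung F-C1 not moved.
-/

noncomputable section

namespace Summit.Ventures.Crystal3D.Theorems

open Summit.Ventures.Crystal3D Finset Matrix NearIdentity
open Literature.MathematicalPhysics.StatisticalMechanics (barlowPos barlowStacking fccStacking
  constHagg IsHaggSeq haggLabel_const barlowPos_mem)
open scoped InnerProductSpace

/-- Orthonormal CUBIC COORDINATES of `x ∈ ℝ³`: `(A x, B x, C x)/√2` with the cubic-frame functionals of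
`…NoReconstructionGainCubicFrame` (`2‖x‖² = A² + B² + C²`). -/
def cubicCoords (x : EuclideanSpace ℝ (Fin 3)) : Fin 3 → ℝ :=
  ![(x 0 + Real.sqrt 3 / 3 * x 1 - Real.sqrt (2 / 3) * x 2) / Real.sqrt 2,
    (x 0 - Real.sqrt 3 / 3 * x 1 + Real.sqrt (2 / 3) * x 2) / Real.sqrt 2,
    (2 * Real.sqrt 3 / 3 * x 1 + Real.sqrt (2 / 3) * x 2) / Real.sqrt 2]

/-- The cubic frame: the three unit vectors whose cubic coordinates are the standard basis. -/
def cubicFrame (i : Fin 3) : EuclideanSpace ℝ (Fin 3) :=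
  ![!₂[1 / Real.sqrt 2, Real.sqrt 3 / 3 / Real.sqrt 2, -(Real.sqrt (2 / 3) / Real.sqrt 2)],
    !₂[1 / Real.sqrt 2, -(Real.sqrt 3 / 3 / Real.sqrt 2), Real.sqrt (2 / 3) / Real.sqrt 2],
    !₂[0, 2 * Real.sqrt 3 / 3 / Real.sqrt 2, Real.sqrt (2 / 3) / Real.sqrt 2]] i

/-- Cubic coordinates are additive. -/
theorem cubicCoords_add (x y : EuclideanSpace ℝ (Fin 3)) : cubicCoords (x + y) = cubicCoords x + cubicCoords y := by
  ext i; fin_cases i <;> simp [cubicCoords] <;> ring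

/-- Cubic coordinates are homogeneous. -/
theorem cubicCoords_smul (r : ℝ) (x : EuclideanSpace ℝ (Fin 3)) : cubicCoords (r • x) = r • cubicCoords x := by
  ext i; fin_cases i <;> simp [cubicCoords] <;> ring

/-- Cubic coordinates respect subtraction. -/
theorem cubicCoords_sub (x y : EuclideanSpace ℝ (Fin 3)) : cubicCoords (x - y) = cubicCoords x - cubicCoords y := by
  ext i; fin_cases i <;> simp [cubicCoords] <;> ring

/-- `‖x‖² = |cubicCoords x|²` (the cubic frame is orthonormal; `two_mul_norm_sq_eq_cubic`). -/
theorem norm_sq_eq_cubicCoords (x : EuclideanSpace ℝ (Fin 3)) : ‖x‖ ^ 2 = cubicCoords x ⬝ᵥ cubicCoords x := by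
  have h := two_mul_norm_sq_eq_cubic x
  have hs : Real.sqrt 2 ^ 2 = 2 := Real.sq_sqrt (by norm_num)
  have hs0 : Real.sqrt 2 ≠ 0 := by positivity
  simp only [cubicCoords, dotProduct, Fin.sum_univ_three, Matrix.cons_val_zero, Matrix.cons_val_one,
    Matrix.head_cons, Matrix.cons_val_two, Matrix.tail_cons]
  field_simp
  rw [hs]; linarith

/-- **Parseval in the cubic frame:** `⟪x, y⟫ = cubicCoords x ⬝ cubicCoords y`. -/
theorem inner_eq_cubicCoords (x y : EuclideanSpace ℝ (Fin 3)) : ⟪x, y⟫_ℝ = cubicCoords x ⬝ᵥ cubicCoords y := by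
  have h := norm_add_sq_real x y
  rw [norm_sq_eq_cubicCoords, norm_sq_eq_cubicCoords, norm_sq_eq_cubicCoords, cubicCoords_add] at h
  simp only [dotProduct, Fin.sum_univ_three, Pi.add_apply] at h ⊢
  linarith

/-- The cubic coordinates of the frame vectors are the standard basis vectors. -/
theorem cubicCoords_cubicFrame (i : Fin 3) : cubicCoords (cubicFrame i) = Pi.single i 1 := by
  have hs : Real.sqrt 2 ^ 2 = 2 := Real.sq_sqrt (by norm_num)
  have h3 : Real.sqrt 3 ^ 2 = 3 := Real.sq_sqrt (by norm_num)
  have h23 : Real.sqrt (2 / 3) ^ 2 = 2 / 3 := Real.sq_sqrt (by norm_num)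
  have hs0 : Real.sqrt 2 ≠ 0 := by positivity
  have h30 : Real.sqrt 3 ≠ 0 := by positivity
  ext j
  fin_cases i <;> fin_cases j <;> simp [cubicCoords, cubicFrame] <;> field_simp <;> nlinarith [hs, h3, h23]

/-- `⟪x, cᵢ⟫ = (cubicCoords x)ᵢ`. -/
theorem inner_cubicFrame (x : EuclideanSpace ℝ (Fin 3)) (i : Fin 3) : ⟪x, cubicFrame i⟫_ℝ = cubicCoords x i := by
  rw [inner_eq_cubicCoords, cubicCoords_cubicFrame, dotProduct_single, mul_one]

/-! ### The matrix of a linear isometry in the cubic frame -/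

/-- `cubicCoords (L w) = M *ᵥ cubicCoords w` with `M i j = cubicCoords (L cⱼ) i`. -/
theorem cubicCoords_map (L : EuclideanSpace ℝ (Fin 3) ≃ₗᵢ[ℝ] EuclideanSpace ℝ (Fin 3))
    (w : EuclideanSpace ℝ (Fin 3)) :
    cubicCoords (L w) = (Matrix.of fun i j => cubicCoords (L (cubicFrame j)) i) *ᵥ cubicCoords w := by
  ext i
  have h1 : cubicCoords (L w) i = ⟪w, L.symm (cubicFrame i)⟫_ℝ := by
    rw [← inner_cubicFrame]
    conv_lhs => rw [← L.apply_symm_apply (cubicFrame i)]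
    rw [L.inner_map_map]
  have h2 : ∀ j, cubicCoords (L.symm (cubicFrame i)) j = cubicCoords (L (cubicFrame j)) i := by
    intro j
    rw [← inner_cubicFrame, ← inner_cubicFrame, ← L.inner_map_map, L.apply_symm_apply, real_inner_comm]
  rw [h1, inner_eq_cubicCoords]
  simp only [Matrix.mulVec, dotProduct, Matrix.of_apply]
  exact Finset.sum_congr rfl fun j _ => by rw [h2 j]; ring

/-- The matrix of a linear isometry in the cubic frame is orthogonal:  `Σ_l M_{li} M_{lj} = δ_{ij}`. -/
theorem cubicMatrix_orthogonal (L : EuclideanSpace ℝ (Fin 3) ≃ₗᵢ[ℝ] EuclideanSpace ℝ (Fin 3)) (i j : Fin 3) :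
    ∑ l, cubicCoords (L (cubicFrame i)) l * cubicCoords (L (cubicFrame j)) l = if i = j then 1 else 0 := by
  have h : ⟪L (cubicFrame i), L (cubicFrame j)⟫_ℝ = ⟪cubicFrame i, cubicFrame j⟫_ℝ := L.inner_map_map _ _
  rw [inner_eq_cubicCoords, inner_cubicFrame, cubicCoords_cubicFrame] at h
  simp only [dotProduct] at h
  rw [h, Pi.single_apply]
  by_cases hij : i = j
  · rw [if_pos hij, if_pos hij.symm]
  · rw [if_neg hij, if_neg (fun e => hij e.symm)]

/-- `horth` for `κ = M − 1`:  `κᵢⱼ + κⱼᵢ + Σ_l κ_{li} κ_{lj} = 0`. -/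
theorem cubicMatrix_horth (L : EuclideanSpace ℝ (Fin 3) ≃ₗᵢ[ℝ] EuclideanSpace ℝ (Fin 3)) :
    ∀ i j : Fin 3,
      ((Matrix.of fun i j => cubicCoords (L (cubicFrame j)) i) - 1) i j +
        ((Matrix.of fun i j => cubicCoords (L (cubicFrame j)) i) - 1) j i +
        ∑ l, ((Matrix.of fun i j => cubicCoords (L (cubicFrame j)) i) - 1) l i *
          ((Matrix.of fun i j => cubicCoords (L (cubicFrame j)) i) - 1) l j = 0 := by
  intro i j
  have h := cubicMatrix_orthogonal L i j
  fin_cases i <;> fin_cases j <;>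
    simp only [Fin.sum_univ_three, Fin.isValue, Fin.zero_eta, Fin.mk_one, Fin.reduceFinMk, Matrix.sub_apply,
      Matrix.of_apply, Matrix.one_apply] at h ⊢ <;>
    simp at h ⊢ <;> linarith [h]

/-- Frobenius norm of `κ = M − 1` = `Σⱼ ‖L cⱼ − cⱼ‖²`. -/
theorem cubicMatrix_frob (L : EuclideanSpace ℝ (Fin 3) ≃ₗᵢ[ℝ] EuclideanSpace ℝ (Fin 3)) :
    ∑ i, ∑ j, ((Matrix.of fun i j => cubicCoords (L (cubicFrame j)) i) - 1) i j ^ 2 =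
      ∑ j, ‖L (cubicFrame j) - cubicFrame j‖ ^ 2 := by
  rw [Finset.sum_comm]
  refine Finset.sum_congr rfl fun j _ => ?_
  rw [norm_sq_eq_cubicCoords, cubicCoords_sub, cubicCoords_cubicFrame]
  simp only [dotProduct, Matrix.sub_apply, Matrix.of_apply, Matrix.one_apply, Pi.sub_apply, Pi.single_apply]
  refine Finset.sum_congr rfl fun i _ => ?_
  by_cases h : i = j
  · subst h; simp; ring
  · simp [h]; ring

/-! ### The twelve slots as lattice vectors -/

/-- The `(k, i, j)` indices of the twelve slots, in the order of `NearIdentity.slotInt`. -/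
def slotKIJ : Fin 12 → ℤ × ℤ × ℤ := ![(0, 1, 0), (-1, 0, 1), (1, 0, -1), (0, -1, 0), (0, 0, 1), (-1, 1, 0), (1, -1, 0), (0, 0, -1), (1, 0, 0), (0, 1, -1), (0, -1, 1), (-1, 0, 0)]

/-- The slot `k` as a vector of `Λ₀`. -/
def slotSite (k : Fin 12) : EuclideanSpace ℝ (Fin 3) :=
  barlowPos 1 (Real.sqrt (2 / 3)) constHagg (slotKIJ k).1 (slotKIJ k).2.1 (slotKIJ k).2.2

/-- Table check: `slotKIJ` enumerates `fccSlotTriples` and its cubic coordinates are `slotInt`. -/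
theorem slotKIJ_facts :
    (∀ k : Fin 12, slotKIJ k ∈ fccSlotTriples ∧
      ((slotKIJ k).2.1 + (slotKIJ k).2.2 = slotInt k 0 ∧ (slotKIJ k).2.1 + (slotKIJ k).1 = slotInt k 1 ∧
        (slotKIJ k).2.2 + (slotKIJ k).1 = slotInt k 2)) ∧
    (∀ c ∈ fccSlotTriples, ∃ k : Fin 12, slotKIJ k = c) ∧ Function.Injective slotKIJ := by
  refine ⟨by decide, by decide, by decide⟩

/-- Slots are slots. -/
theorem slotSite_mem (k : Fin 12) : slotSite k ∈ fccSlots := by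
  rw [fccSlots, Finset.mem_image]
  exact ⟨slotKIJ k, (slotKIJ_facts.1 k).1, rfl⟩

/-- Every slot is a `slotSite`. -/
theorem exists_slotSite_eq {w : EuclideanSpace ℝ (Fin 3)} (hw : w ∈ fccSlots) : ∃ k, slotSite k = w := by
  rw [fccSlots, Finset.mem_image] at hw
  obtain ⟨c, hc, rfl⟩ := hw
  obtain ⟨k, hk⟩ := slotKIJ_facts.2.1 c hc
  exact ⟨k, by rw [slotSite, hk]⟩

/-- `slotSite` is injective. -/
theorem slotSite_injective : Function.Injective slotSite := by
  intro k l h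
  have := barlowPos_fcc_injective h
  apply slotKIJ_facts.2.2
  simp only [Prod.mk.injEq] at this
  exact Prod.ext this.1 (Prod.ext this.2.1 this.2.2)

/-- The cubic coordinates of the slots are the vectors `slotVec` of `…CutNormals`. -/
theorem cubicCoords_slotSite (k : Fin 12) : cubicCoords (slotSite k) = slotVec k := by
  obtain ⟨-, hA, hB, hC⟩ := slotKIJ_facts.1 k
  obtain ⟨cA, cB, cC⟩ := cubic_barlowPos (slotKIJ k).1 (slotKIJ k).2.1 (slotKIJ k).2.2
  have hA' : ((slotKIJ k).2.1 : ℝ) + (slotKIJ k).2.2 = slotInt k 0 := by exact_mod_cast hA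
  have hB' : ((slotKIJ k).2.1 : ℝ) + (slotKIJ k).1 = slotInt k 1 := by exact_mod_cast hB
  have hC' : ((slotKIJ k).2.2 : ℝ) + (slotKIJ k).1 = slotInt k 2 := by exact_mod_cast hC
  unfold cubicCoords slotVec slotSite
  rw [cA, cB, cC, hA', hB', hC']
  ext i
  fin_cases i <;> simp

/-- `cubicCoords` is injective (the frame is orthonormal). -/
theorem cubicCoords_injective : Function.Injective cubicCoords := by
  intro x y h
  have h0 : ‖x - y‖ ^ 2 = 0 := by
    rw [norm_sq_eq_cubicCoords, cubicCoords_sub, h, sub_self]; simp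
  have : ‖x - y‖ = 0 := by simpa using h0
  exact sub_eq_zero.1 (norm_eq_zero.1 this)

/-- `fccSlots` is the image of `slotSite`. -/
theorem fccSlots_eq_image : fccSlots = Finset.univ.image slotSite := by
  ext w
  constructor
  · intro hw
    obtain ⟨k, hk⟩ := exists_slotSite_eq hw
    exact Finset.mem_image.2 ⟨k, Finset.mem_univ _, hk⟩
  · intro hw
    obtain ⟨k, -, rfl⟩ := Finset.mem_image.1 hw
    exact slotSite_mem k

/-- The frame vectors are `1/√2` times sums/differences of two slots. -/
theorem cubicFrame_eq_slots :
    cubicFrame 0 = (1 / Real.sqrt 2) • (slotSite 0 + slotSite 1) ∧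
    cubicFrame 1 = (1 / Real.sqrt 2) • (slotSite 0 - slotSite 1) ∧
    cubicFrame 2 = (1 / Real.sqrt 2) • (slotSite 4 - slotSite 5) := by
  have hs : Real.sqrt 2 ^ 2 = 2 := Real.sq_sqrt (by norm_num)
  have hs0 : Real.sqrt 2 ≠ 0 := by positivity
  refine ⟨cubicCoords_injective ?_, cubicCoords_injective ?_, cubicCoords_injective ?_⟩ <;>
    simp only [cubicCoords_smul, cubicCoords_add, cubicCoords_sub, cubicCoords_slotSite,
      cubicCoords_cubicFrame] <;>
    ext i <;> fin_cases i <;> simp only [Pi.single_apply] <;> simp [slotVec, slotInt] <;> field_simp <;>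
    linarith [hs]

end Summit.Ventures.Crystal3D.Theorems

end
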